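import Summits.Schanuel.Schanuel.Theorems.ZilberEacGraphRamifiedBranch
import HarnessLib

/-!
# The equimodular class, LXVI: THE MASTER THEOREM over polynomial graphs — a cycle at infinity and
# a parametrised zero or pole branch give Zariski density

HONEST FRAMING.  Cell `pub-schanuel` (Zilber's Exponential-Algebraic Closedness, case ladder;
host summit Schanuel), seat 2, gen 26.  Every surface theorem of gens 24–26 for fibre curves
`W = {x₁ = p(x₀), Q(x₀, y₀) = 0}` over a polynomial graph (`deg p ≥ 2`, `P` irreducible) is an
instance of the following statement, isolated here with BOTH local data abstract:
**`unprojectedDense_graph_cycle_zeroBranch`** — if the fibre curve has (∞) an analytically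
parametrised cycle at infinity `x₀ = s^{-k}`, `y₀ = ψ(s)`, `ψ(0) = θ ≠ 0` (`k ≥ 1`; files LIII, LXV
supply these from the top rows), and (0) an analytically parametrised ZERO branch `x₀ = γ(t)`,
`y₀ = η(t)`, `η(0) = 0`, `η ≢ 0`, `γ' ≠ 0` off `t = 0` (files XLII, XLIX, LI, LIV, and any finite
chain of Newton–Puiseux steps, supply these), then `I(W ∩ Γ_exp) = I(W)`;
**`unprojectedDense_graph_cycle_poleBranch`** — the same with a POLE branch `y₀ = 1/η(t)` (`q₀ ≠ 0`).
Proof: file LXII (non-density ⟹ `log ψ(z^{-1/k})` algebraic) against file XLVIII (the logarithm of an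
algebraic branch is transcendental along a parametrised zero/pole branch).  Also
**`exists_newtonBranch_twoStep`**: composing two Newton–Puiseux steps into one parametrised zero
branch (for fibres all of whose zeros need two steps).  Complete classes of instances of an OPEN
question (Mantova–Masser, PLMS 2024 §1 p. 5); EC(3,2) OPEN; NOT Schanuel's conjecture (neither used
nor implied); EAC ⇏ SC.
-/

noncomputable section

open Filter Topology Set Complex MvPolynomial
open Literature.NumberTheory.Transcendental Literature.ModelTheory.Zilber
open Literature.ModelTheory.ExponentialFields

set_option linter.dupNamespace false

namespace Summit.Schanuel.Schanuel.Theorems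

/-! ## Part A. The master theorems -/

/-- **Cycle at infinity + parametrised zero branch ⟹ dense.**  See the module docstring.
[cite: MantovaMasser2023, §1 Further remarks, p. 5 (the question, open in general)] (new) -/
theorem unprojectedDense_graph_cycle_zeroBranch (Q : Polynomial (Polynomial ℂ))
    {P : MvPolynomial (Fin 2) ℂ}
    (hP : ∀ x y : ℂ, MvPolynomial.eval ![x, y] P = (Q.map (Polynomial.evalRingHom x)).eval y)
    (hirr : Irreducible P) (hQ1 : Q.natDegree ≠ 0) {k : ℕ} (hk : 1 ≤ k)
    {ψ : ℂ → ℂ} (hψ : AnalyticAt ℂ ψ 0) {θ : ℂ} (hθ0 : θ ≠ 0) (hψ0 : ψ 0 = θ)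
    (hbranch : ∀ᶠ s in 𝓝[≠] (0 : ℂ), (Q.map (Polynomial.evalRingHom (s ^ k)⁻¹)).eval (ψ s) = 0)
    {γ η : ℂ → ℂ} (hγan : AnalyticAt ℂ γ 0) (hηan : AnalyticAt ℂ η 0) (hη0 : η 0 = 0)
    (hγ' : ∀ᶠ t in 𝓝[≠] (0 : ℂ), deriv γ t ≠ 0) (hηne : ¬ ∀ᶠ t in 𝓝 (0 : ℂ), η t = 0)
    (hQγ : ∀ᶠ t in 𝓝 (0 : ℂ), (Q.map (Polynomial.evalRingHom (γ t))).eval (η t) = 0)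
    (p : Polynomial ℂ) (hd : 2 ≤ p.natDegree) :
    UnprojectedDense {w : Fin 2 ⊕ Fin 2 → ℂ | w (Sum.inl 1) = p.eval (w (Sum.inl 0)) ∧
      MvPolynomial.eval ![w (Sum.inl 0), w (Sum.inr 0)] P = 0} := by
  by_contra hnot
  have hQirr : Irreducible Q := (irreducible_rows_iff hP).1 hirr
  obtain ⟨z₀, ρ, L, hLan, hρan, hρ0, hQρ, hL, hLalg⟩ :=
    exists_algebraic_log_of_not_dense_ramified Q hP hirr hQ1 hk hψ hθ0 hψ0 hbranch p hd hnot
  exact not_isAlgebraic_log_algebraicBranch_param Q hQirr hQ1 hγan hηan hη0 hγ' hηne hQγ hρan hLan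
    hρ0 hQρ hL hLalg

/-- **Cycle at infinity + parametrised pole branch ⟹ dense** (`q₀ ≠ 0`, `y₀ = 1/η(t)`).
[cite: MantovaMasser2023, §1 Further remarks, p. 5 (the question, open in general)] (new) -/
theorem unprojectedDense_graph_cycle_poleBranch (Q : Polynomial (Polynomial ℂ))
    {P : MvPolynomial (Fin 2) ℂ}
    (hP : ∀ x y : ℂ, MvPolynomial.eval ![x, y] P = (Q.map (Polynomial.evalRingHom x)).eval y)
    (hirr : Irreducible P) (hQ1 : Q.natDegree ≠ 0) (hQ00 : Q.coeff 0 ≠ 0) {k : ℕ} (hk : 1 ≤ k)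
    {ψ : ℂ → ℂ} (hψ : AnalyticAt ℂ ψ 0) {θ : ℂ} (hθ0 : θ ≠ 0) (hψ0 : ψ 0 = θ)
    (hbranch : ∀ᶠ s in 𝓝[≠] (0 : ℂ), (Q.map (Polynomial.evalRingHom (s ^ k)⁻¹)).eval (ψ s) = 0)
    {γ η : ℂ → ℂ} (hγan : AnalyticAt ℂ γ 0) (hηan : AnalyticAt ℂ η 0) (hη0 : η 0 = 0)
    (hγ' : ∀ᶠ t in 𝓝[≠] (0 : ℂ), deriv γ t ≠ 0) (hηne : ¬ ∀ᶠ t in 𝓝 (0 : ℂ), η t = 0)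
    (hQγ : ∀ᶠ t in 𝓝[≠] (0 : ℂ), (Q.map (Polynomial.evalRingHom (γ t))).eval (η t)⁻¹ = 0)
    (p : Polynomial ℂ) (hd : 2 ≤ p.natDegree) :
    UnprojectedDense {w : Fin 2 ⊕ Fin 2 → ℂ | w (Sum.inl 1) = p.eval (w (Sum.inl 0)) ∧
      MvPolynomial.eval ![w (Sum.inl 0), w (Sum.inr 0)] P = 0} := by
  by_contra hnot
  have hQirr : Irreducible Q := (irreducible_rows_iff hP).1 hirr
  obtain ⟨z₀, ρ, L, hLan, hρan, hρ0, hQρ, hL, hLalg⟩ :=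
    exists_algebraic_log_of_not_dense_ramified Q hP hirr hQ1 hk hψ hθ0 hψ0 hbranch p hd hnot
  exact not_isAlgebraic_log_algebraicBranch_param_pole Q hQirr hQ1 hQ00 hγan hηan hη0 hγ' hηne hQγ hρan
    hLan hρ0 hQρ hL hLalg

/-! ## Part B. Two Newton–Puiseux steps composed into one parametrised zero branch -/

/-- **Two Newton–Puiseux steps.**  A first datum `Q(a + t^e)(t^μ w) = t^ν Q̃(t)(w)` (`μ ≥ 1`) and,
at a nonzero root `w₀` of `Q̃(0)(·)` of any multiplicity, a second datum for the shifted polynomial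
`Q̃(t)(w₀ + v)`: `Q̃(τ^{e'})(w₀ + τ^{μ'} v) = τ^{ν'} Q̃₂(τ)(v)` (`e' ≥ 1`, `μ' ≥ 1`) whose `Q̃₂(0)(·)`
has a simple nonzero root.  Then there is a parametrised zero branch `z = a + τ^{e e'}`, `y = η(τ)`,
`η` analytic at `0`, `η(0) = 0`, `η ≢ 0`, `Q(a + τ^{ee'})(η τ) = 0` near `0`.
[folklore (Newton–Puiseux), made concrete] (new in this form) -/
theorem exists_newtonBranch_twoStep (Q Qt Qt₂ : Polynomial (Polynomial ℂ)) (a : ℂ) {e μ ν : ℕ}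
    (hμ : 1 ≤ μ)
    (hid : ∀ t w : ℂ, t ≠ 0 → w ≠ 0 →
      (Q.map (Polynomial.evalRingHom (a + t ^ e))).eval (t ^ μ * w) =
        t ^ ν * (Qt.map (Polynomial.evalRingHom t)).eval w)
    {w₀ : ℂ} (hw₀ : w₀ ≠ 0) {e' μ' ν' : ℕ} (he' : 1 ≤ e') (hμ' : 1 ≤ μ')
    (hid₂ : ∀ τ v : ℂ, τ ≠ 0 → v ≠ 0 →
      (Qt.map (Polynomial.evalRingHom (τ ^ e'))).eval (w₀ + τ ^ μ' * v) =
        τ ^ ν' * (Qt₂.map (Polynomial.evalRingHom τ)).eval v)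
    {v₀ : ℂ} (hv₀ : v₀ ≠ 0) (hroot : (Qt₂.map (Polynomial.evalRingHom 0)).IsRoot v₀)
    (hsimple : ¬ ((Polynomial.derivative Qt₂).map (Polynomial.evalRingHom 0)).IsRoot v₀) :
    ∃ η : ℂ → ℂ, AnalyticAt ℂ η 0 ∧ η 0 = 0 ∧ (¬ ∀ᶠ τ in 𝓝 (0 : ℂ), η τ = 0) ∧
      ∀ᶠ τ in 𝓝 (0 : ℂ), (Q.map (Polynomial.evalRingHom (a + τ ^ (e' * e)))).eval (η τ) = 0 := by
  -- the branch of `Q̃₂ = 0` through `(0, v₀)` and the resulting branch `w = w₀ + τ^{μ'} v(τ)` of `Q̃`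
  obtain ⟨v, hvan, hv0, hvroot⟩ := exists_branchAt Qt₂ hroot hsimple
  have hvne : ∀ᶠ τ in 𝓝 (0 : ℂ), v τ ≠ 0 := hvan.continuousAt.eventually_ne (by rw [hv0]; exact hv₀)
  set wf : ℂ → ℂ := fun τ => w₀ + τ ^ μ' * v τ with hwf
  have hwfan : AnalyticAt ℂ wf 0 := analyticAt_const.add ((analyticAt_id.pow μ').mul hvan)
  have hwf0 : wf 0 = w₀ := by simp [hwf, zero_pow (by omega : μ' ≠ 0)]
  have hwfne : ∀ᶠ τ in 𝓝 (0 : ℂ), wf τ ≠ 0 := hwfan.continuousAt.eventually_ne (by rw [hwf0]; exact hw₀)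
  -- the composite branch `η(τ) = (τ^{e'})^μ · wf(τ)` over `z = a + (τ^{e'})^e`
  set η : ℂ → ℂ := fun τ => (τ ^ e') ^ μ * wf τ with hη
  have hηan : AnalyticAt ℂ η 0 := ((analyticAt_id.pow e').pow μ).mul hwfan
  have hη0 : η 0 = 0 := by
    simp only [hη, zero_pow (by omega : e' ≠ 0), zero_pow (by omega : μ ≠ 0), zero_mul]
  -- `Q(a + τ^{e'e}, η τ) = 0` for `τ ≠ 0` near `0`
  have hpunct : ∀ᶠ τ in 𝓝[≠] (0 : ℂ),
      (Q.map (Polynomial.evalRingHom (a + τ ^ (e' * e)))).eval (η τ) = 0 := by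
    filter_upwards [self_mem_nhdsWithin, nhdsWithin_le_nhds hvroot, nhdsWithin_le_nhds hvne,
      nhdsWithin_le_nhds hwfne] with τ (hτ : τ ≠ 0) hQτ hvτ hwτ
    have h1 := hid (τ ^ e') (wf τ) (pow_ne_zero _ hτ) hwτ
    have h2 := hid₂ τ (v τ) hτ hvτ
    rw [hQτ, mul_zero] at h2
    rw [hη, pow_mul]
    change (Q.map (Polynomial.evalRingHom (a + (τ ^ e') ^ e))).eval ((τ ^ e') ^ μ * wf τ) = 0
    rw [h1]
    change (τ ^ e') ^ ν * (Qt.map (Polynomial.evalRingHom (τ ^ e'))).eval (w₀ + τ ^ μ' * v τ) = 0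
    rw [h2, mul_zero]
  -- hence near `0` (continuity at `τ = 0`, where both sides vanish)
  have hcont : ContinuousAt (fun τ : ℂ => (Q.map (Polynomial.evalRingHom (a + τ ^ (e' * e)))).eval (η τ)) 0 := by
    have e1 : (fun τ : ℂ => (Q.map (Polynomial.evalRingHom (a + τ ^ (e' * e)))).eval (η τ)) =
        fun τ => ∑ j ∈ Finset.range (Q.natDegree + 1), (Q.coeff j).eval (a + τ ^ (e' * e)) * η τ ^ j := by
      funext τ; exact evalPP_eq_sum Q _ _ (Nat.lt_succ_self _)
    rw [e1]
    refine tendsto_finsetSum _ fun j _ => ?_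
    have hin : ContinuousAt (fun τ : ℂ => a + τ ^ (e' * e)) 0 := continuousAt_const.add (continuousAt_id.pow _)
    exact ((analyticAt_polynomial_eval (Q.coeff j) _).continuousAt.comp (f := fun τ : ℂ => a + τ ^ (e' * e))
      hin).mul (hηan.continuousAt.pow j)
  have hall : ∀ᶠ τ in 𝓝 (0 : ℂ), (Q.map (Polynomial.evalRingHom (a + τ ^ (e' * e)))).eval (η τ) = 0 := by
    have hat : (Q.map (Polynomial.evalRingHom (a + (0 : ℂ) ^ (e' * e)))).eval (η 0) = 0 :=
      eq_at_of_eventuallyEq_punctured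
        (F := fun τ : ℂ => (Q.map (Polynomial.evalRingHom (a + τ ^ (e' * e)))).eval (η τ))
        (G := fun _ => (0 : ℂ)) hcont continuousAt_const hpunct
    have h' := eventually_nhdsWithin_iff.1 hpunct
    filter_upwards [h'] with τ hτ
    by_cases h0 : τ = 0
    · rw [h0]; exact hat
    · exact hτ h0
  refine ⟨η, hηan, hη0, ?_, hall⟩
  intro hzero
  have h2 : ∀ᶠ τ in 𝓝[≠] (0 : ℂ), False := by
    filter_upwards [self_mem_nhdsWithin, nhdsWithin_le_nhds hzero, nhdsWithin_le_nhds hwfne]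
      with τ (hτ : τ ≠ 0) hητ hwτ
    rw [hη] at hητ
    exact (mul_ne_zero (pow_ne_zero _ (pow_ne_zero _ hτ)) hwτ) hητ
  exact h2.exists.elim fun _ h => h

end Summit.Schanuel.Schanuel.Theorems
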